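import Literature.AlgebraicGeometry.HodgeTheory.VeryGeneralHypersurfaceHodgeConjecture
import Literature.AlgebraicGeometry.HodgeTheory.MotivatedClassesDeformation
import Literature.AlgebraicGeometry.Motives.SpecialisedHypersurfaceFamily
import HarnessLib

/-!
# The fibres of a specialised hypersurface family are closed subschemes of `ℙⁿ⁺¹` through the total
# space

Family `hodge`, layer `Literature/AlgebraicGeometry/Motives`. Theorems only (no definition, no named
fact). Written by the prover seat `hodge-nonav-20241-p1` (g17, cell `hodge-nonav`) as glue for brick F-G
of prover-Ax's programme «B4 RELATIVE RESIDUES» (route `HodgeConjecture/CyclicUnitaryPowers`,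
`--supports stmt-HodgeConjecture-19544`): the hypothesis
`hε : ∀ t, IsClosedImmersion (fiberι f t ≫ ε).left` of `hodgeLociDichotomy_of_weightTwoFrames`
(`HodgeLociDichotomyOfWeightTwoFrames`) for the specialised families `f = familySpz k n d φ`
(`SpecialisedHypersurfaceFamily`: the base change of the universal degree-`d` hypersurface family in
`ℙⁿ⁺¹` along a coefficient specialisation `φ`; e.g. the Carlson–Toledo cyclic-cover family and the
Dwork pencil) with `ε := totalSpzToTotal k n d φ ≫ Literature.AlgebraicGeometry.HodgeTheory.UniversalHypersurface.toProjectiveSpace k n d`.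

* `fiberι_familySpz_comp_totalSpzToTotal` — `ι_t ≫ (𝒳_φ → 𝒴) = e_t ≫ ι_{φ t}` for the base-change
  isomorphism `e_t : (𝒳_φ)_t ≅ 𝒴_{φ t}` of the fibres (`fiberOverFamilyPullbackIso`).
* `isClosedImmersion_fiberι_familySpz_toProjectiveSpace` — **`(𝒳_φ)_t ⟶ 𝒳_φ ⟶ 𝒴 ⟶ ℙⁿ⁺¹` is a closed
  immersion** (an isomorphism followed by the closed immersion `𝒴_{φ t} ↪ ℙⁿ⁺¹`,
  `HodgeTheory.UniversalHypersurface.isClosedImmersion_fiberι_toProjectiveSpace_left`).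

## References

* [VoisinHodgeII2003] C. Voisin, Hodge Theory and Complex Algebraic Geometry II (2003), §6.2.1 (the
  universal hypersurface and its fibres).
* [Hartshorne1977] R. Hartshorne, Algebraic Geometry (1977), II Ex. 3.11 (a) (closed immersions are
  stable under base change and composition with isomorphisms).
-/

noncomputable section

open CategoryTheory AlgebraicGeometry

namespace Literature.AlgebraicGeometry.Motives.UniversalHypersurface

section Fibre

universe u

variable (k : Type u) [Field k] (n d : ℕ) {ι : Type}
  (φ : CoeffRing k n d →ₐ[k] MvPolynomial ι k)

/-- **The fibre inclusion of the specialised family composed with the map to the universal total space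
is the base-change isomorphism of fibres followed by the universal fibre inclusion**:
`ι_t ≫ (𝒳_φ → 𝒴) = e_t.hom ≫ ι_{φ t}` (`fiberOverFamilyPullbackIso_hom_fiberι`).
[cite: Hartshorne1977, II Ex. 3.11 (a)] -/
theorem fiberι_familySpz_comp_totalSpzToTotal (t : AlgPoints (baseSpz k n d φ) k) :
    fiberι (familySpz k n d φ) t ≫ totalSpzToTotal k n d φ =
      (show fiberOver (familySpz k n d φ) t ≅ fiberOver (family k n d) (AlgPoints.map (toBaseSpz k n d φ) t)
        from fiberOverFamilyPullbackIso (family k n d) (toBaseSpz k n d φ) t).hom ≫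
        fiberι (family k n d) (AlgPoints.map (toBaseSpz k n d φ) t) :=
  (fiberOverFamilyPullbackIso_hom_fiberι (family k n d) (toBaseSpz k n d φ) t).symm

/-- **The fibres of a specialised hypersurface family are closed subschemes of `ℙⁿ⁺¹` through the total
space**: `(𝒳_φ)_t ⟶ 𝒳_φ ⟶ 𝒴 ⟶ ℙⁿ⁺¹_k` is a closed immersion — the base-change isomorphism
`(𝒳_φ)_t ≅ 𝒴_{φ t}` followed by the closed immersion `𝒴_{φ t} ↪ ℙⁿ⁺¹`
(`HodgeTheory.UniversalHypersurface.isClosedImmersion_fiberι_toProjectiveSpace_left`). This is the hypothesis `hε`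
of `hodgeLociDichotomy_of_weightTwoFrames` for `ε := totalSpzToTotal ≫ toProjectiveSpace`.
[cite: VoisinHodgeII2003, §6.2.1] [cite: Hartshorne1977, II Ex. 3.11 (a)] -/
theorem isClosedImmersion_fiberι_familySpz_toProjectiveSpace (t : AlgPoints (baseSpz k n d φ) k) :
    IsClosedImmersion (fiberι (familySpz k n d φ) t ≫
      (totalSpzToTotal k n d φ ≫
        Literature.AlgebraicGeometry.HodgeTheory.UniversalHypersurface.toProjectiveSpace k n d)).left := by
  haveI := Literature.AlgebraicGeometry.HodgeTheory.UniversalHypersurface.isClosedImmersion_fiberι_toProjectiveSpace_left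
    k n d (AlgPoints.map (toBaseSpz k n d φ) t)
  set e : fiberOver (familySpz k n d φ) t ≅ fiberOver (family k n d) (AlgPoints.map (toBaseSpz k n d φ) t) :=
    fiberOverFamilyPullbackIso (family k n d) (toBaseSpz k n d φ) t with he
  have heq : fiberι (familySpz k n d φ) t ≫
      (totalSpzToTotal k n d φ ≫
        Literature.AlgebraicGeometry.HodgeTheory.UniversalHypersurface.toProjectiveSpace k n d) =
      e.hom ≫ (fiberι (family k n d) (AlgPoints.map (toBaseSpz k n d φ) t) ≫
        Literature.AlgebraicGeometry.HodgeTheory.UniversalHypersurface.toProjectiveSpace k n d) := by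
    rw [← Category.assoc, fiberι_familySpz_comp_totalSpzToTotal, Category.assoc]
  rw [heq, Over.comp_left]
  infer_instance

end Fibre

end Literature.AlgebraicGeometry.Motives.UniversalHypersurface

end
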